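import Summits.BirchSwinnertonDyer.BirchSwinnertonDyer.Theorems.SignedLowerHalvesKobayashiLowerHalfLargeImageParityStratum
import HarnessLib

/-!
# Route `SignedLowerHalves`, crux 3 `KobayashiLowerHalfLargeImage` (item stmt-BirchSwinnertonDyer-19001):
# the PARITY STRATUM, part 2 — the full signed MAIN CONJECTURE at a pair from the certificate
# `(μ, λ)(L_p^ε) = (0, 1)` and parity (NO analytic-rank hypothesis), the Mazur–Tate-element forms, and
# the X7 readings (cell `bsd-ssimc`, seat `bsd-line-slh-p1` LEAD gen 12; helper file `--supports 19001`)

HONEST FRAMING: the crux is OPEN and nothing here proves it for the class; BSD is not proved by any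
of this. CONDITIONAL theorems on DISPLAYED binders — the published named facts Kobayashi 2003 Thm. 1.2
(`h12`) / Thm. 4.1 (`h41`, Kato side), the period-unit facts (`h5`, `h3`), Wuthrich 2014 Lemma 20
(`hL20`), the `p`-parity theorem (`hpar : p_parity W p`), Sprung's functional equation of the signed
pair (`hFE : Sprung2017.cor414_sharpFlat_functionalEquation_apZero`) — and ONE per-pair certificate.
CALIBRATION / SUPPORT ONLY (pen rule D34-4 (3)). Companion of `…ParityStratum.lean` (part 1:
§1 the two-coefficient engine, §2 `λ(L_p^ε) = 1 ⇒ w(E) = −1 ∧ T ∣ L_p^ε`, §3 `T ∣ ξ` by parity,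
§4 `kobayashiLowerDivisibility_of_lam_le_one`).

## What this file does

* §5 `kobayashiMainConjecture_of_lam_eq_one_of_p_parity` — `KobayashiMainConjecture W p ε` at a pair
  with `ρ̄_{E,p}` onto and certificate `(μ, λ)(L_p^ε) = (0, 1)` for the newform of level `N_E`: the
  b2b squeeze `kobayashiMainConjecture_of_cert_at_conductor_of_analyticRank_eq_one` (p213197 /
  `SqueezeCertificates.lean`) with its inputs `W.analyticRank = 1` + Gross–Zagier–Kolyvagin REPLACED
  by `p_parity` + `hFE` (part 1 §3 supplies `T ∣ ξ^ε`).
* §6 `kobayashiLowerDivisibility_{neg_one,one}_of_mazurTate`,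
  `kobayashiMainConjecture_{neg_one,one}_of_mazurTate_of_p_parity` — the certificate as ONE
  Mazur–Tate element `Θ` (`ι Θ = θ_n(f₀)`, `μ(Θ) = 0`, `λ(Θ) = deg ω_n^± + l < pⁿ`, `l ≤ 1` resp.
  `l = 1`; bridge `lam_signed_{neg_one,one}_eq_of_mazurTate`, Pollack Prop. 6.9/6.10).
* §7 `X7.exists_kobayashiLowerDivisibility_of_lam_le_one`, `X7.kobayashiMainConjecture_of_lam_eq_one_of_p_parity`
  — class X7 readings in the binder shape of crux 3 (`∃ ε, KobayashiLowerDivisibility W p ε`).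

So per pair the ENTIRE non-published input of "Kobayashi's main conjecture at (E, p, ε)" on the
large-image axis is now ONE `p`-integral polynomial `θ_n` with its first unit coefficient at index
`deg ω_n^± + 1 < pⁿ` — for EVERY analytic rank (the rank-one squeezes needed `r_an = 1` on top).

References: [Kobayashi2003] Thm. 1.2, Thm. 4.1, Conjecture (p. 2); [Pollack2003] Prop. 6.9, 6.10, 6.18;
[Sprung2017] Cor. 4.14; [DokchitserDokchitserAnnals2010] Thm. 1.4; [Wuthrich2014] Lemma 20;
[GreenbergVatsal2000] p. 4. Crux dir: `K1G11-SEARCH-LOG.md` §4.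
-/

set_option autoImplicit false
set_option linter.dupNamespace false

noncomputable section

open scoped Classical MatrixGroups ModularForm

open CongruenceSubgroup PowerSeries WeierstrassCurve Literature.NumberTheory.EllipticCurves
  Literature.NumberTheory.EllipticCurves.ModularForms Literature.Barriers.BirchSwinnertonDyer
  Literature.NumberTheory.EllipticCurves.Rank1Residual Literature.NumberTheory.EllipticCurves.Sprung2017
  Literature.NumberTheory.EllipticCurves.Kobayashi2003 ZpExtension
  Literature.NumberTheory.EllipticCurves.Rank1Residual.Typed
  Summit.BirchSwinnertonDyer.Rank1Residual.X1.MuLambda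
  Summit.BirchSwinnertonDyer.Rank1Residual.Supersingular

namespace Summit.BirchSwinnertonDyer.BirchSwinnertonDyer.Theorems.LargeImageParityStratum

/-! ## §5. The full signed main conjecture at a pair from the certificate `(μ, λ) = (0, 1)` and parity -/

section MainConjecture

variable (W : WeierstrassCurve ℚ) [W.IsElliptic] [W.IsGloballyMinimal] (p : ℕ) [Fact p.Prime]

/-- **Kobayashi's main conjecture for `(E, p, ε)` at a pair with certificate `(μ, λ)(L_p^ε) = (0, 1)`,
WITHOUT any analytic-rank hypothesis.** As the b2b squeeze
`kobayashiMainConjecture_of_cert_at_conductor_of_analyticRank_eq_one` (Kobayashi Thm. 1.2 `h12`,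
Thm. 4.1 `h41` — the Kato side, integral under `p`-adic surjectivity, from mod-`p` surjectivity `hs` via
Wuthrich's Lemma 20 `hL20` at `p = 3` / Serre —, period-unit facts `h5`/`h3`), but with its inputs
`W.analyticRank = 1` + Gross–Zagier–Kolyvagin REPLACED by the `p`-parity theorem (`hpar`) and Sprung's
functional equation (`hFE`): `T ∣ ξ^ε` is §3. Squeeze: `ξ ∣ L_p^ε` (A98), `T ∣ ξ`, `μ(L_p^ε) = 0`,
`λ(L_p^ε) = 1` ⇒ `(ξ) = (L_p^ε)`; then `g := ϖ L_p^ε`, `ϖ ∈ ℤ_p^×`. PER PAIR (certificate `hcert₀` for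
the newform `f₀` of level `N_E`); CONDITIONAL on the displayed binders.
[cite: Kobayashi2003, Thm. 1.2 (p. 2), Thm. 4.1 (p. 8) and Conjecture (p. 2)] [cite: DokchitserDokchitserAnnals2010, Thm. 1.4]
[cite: Sprung2017, Cor. 4.14 (a_p = 0 display)] [cite: Wuthrich2014, Lemma 20 (p. 399)]
[cite: GreenbergVatsal2000, p. 4 and §3 Remark 3.4] -/
theorem kobayashiMainConjecture_of_lam_eq_one_of_p_parity
    (h12 : Kobayashi2003.thm12_signedSelmerDual_finite_torsion)
    (h41 : Kobayashi2003.thm41_signedCharIdeal_divisibility)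
    (h5 : realPeriodRat_eq_unit_mul_plusPeriod) (h3 : realPeriodRat_eq_unit_mul_plusPeriod_three)
    (hL20 : Wuthrich2014.lemma20_surjective_threeAdic_of_semistable)
    (hpar : p_parity W p) (hFE : Sprung2017.cor414_sharpFlat_functionalEquation_apZero)
    (hp : p ≠ 2) (hgood : W.HasGoodReductionAtPrime p) (hap : W.frobeniusTrace p = 0)
    (hs : Surj W p) (ε : ℤˣ)
    [NeZero (W.conductorNorm ℤ)] {f₀ : CuspForm (Gamma0 (W.conductorNorm ℤ)) 2} (hf₀ : IsNewformOf W f₀)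
    (hcert₀ : ∀ L : IwasawaAlgebra p, IsSignedPAdicLFunction f₀ p ε L → mu L = 0 ∧ lam L = 1) :
    KobayashiMainConjecture W p ε := by
  intro κ γ hκ hγ hγ' _ f hf ϖ hϖ Lplus Lminus hPP D
  have hff : f = f₀ := hf.unique hf₀
  subst hff
  haveI : Module.Finite (IwasawaAlgebra p) D.X := h12.moduleFinite hp hgood hap hκ hγ D
  have hX : Module.IsTorsion (IwasawaAlgebra p) D.X := h12.isTorsion hp hgood hap hκ hγ D
  refine ⟨hX, ?_⟩
  obtain ⟨ξ, hξ⟩ := (charIdeal_isPrincipal_holds p D.X).principal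
  have hξ' : D.charIdeal = Ideal.span {ξ} := hξ
  set L := kobayashiL ε Lplus Lminus with hL_def
  have hL : IsSignedPAdicLFunction f p ε L := hPP.isSignedPAdicLFunction_kobayashiL ε
  -- (MC↑), integral: `ξ ∣ L` under `p`-adic surjectivity
  have hsurj : ∀ m : ℕ, W.HasSurjectiveModNGaloisRep (p ^ m : ℕ) :=
    surjective_pow_of_surj_of_good W p hL20 hp hgood hs
  have hU : ξ ∣ L := h41.dvd_of_charIdeal_eq_span hp hgood hap hf hκ hγ hγ' hL D hX hsurj hξ'
  -- the certificate, and `T ∣ ξ` BY PARITY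
  obtain ⟨hμ, hlam⟩ := hcert₀ L hL
  have hC : (X : IwasawaAlgebra p) ∣ ξ :=
    X_dvd_of_charIdeal_eq_span_of_lam_eq_one W p hpar hFE hp hgood hap hf hPP ε hlam hγ D hX hξ'
  have hspan : Ideal.span ({ξ} : Set (IwasawaAlgebra p)) = Ideal.span {L} :=
    span_eq_span_of_dvd_of_X_dvd_of_lam_eq_one hU hC hμ hlam
  -- the period ratio is a `p`-adic unit
  have hirr : W.HasIrreducibleModPGaloisRep p :=
    hasIrreducibleModPGaloisRep_of_dvd_frobeniusTrace W p hp
      (W.not_dvd_minimalDiscriminantInt_of_hasGoodReductionAtPrime' p hgood) (by rw [hap]; exact dvd_zero _)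
  have hvϖ : padicValRat p ϖ = 0 := padicValRat_periodRatio_eq_zero h5 h3 W p hp hgood hirr f hf ϖ hϖ
  have hϖ0 : ϖ ≠ 0 := by
    intro h0
    rw [h0, Rat.cast_zero, zero_mul] at hϖ
    exact (IsNewform0.plusPeriod_pos_holds hf.1 hf.coeffField_eq_bot).ne' hϖ.symm
  obtain ⟨u, hu⟩ := exists_units_coe_eq_ratCast hϖ0 hvϖ
  obtain ⟨hspan', hι⟩ := span_C_units_mul_eq u L
  refine ⟨C (u : ℤ_[p]) * L, ?_, ?_⟩
  · rw [hξ', hspan, hspan']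
  · rw [hι, hu]

end MainConjecture

/-! ## §6. The certificate as ONE Mazur–Tate element -/

section MazurTate

variable (W : WeierstrassCurve ℚ) [W.IsElliptic] [W.IsGloballyMinimal] (p : ℕ) [Fact p.Prime]

/-- **The Eisenstein half for `(E, p, −1)` (the tree's `L⁺`, odd levels) on the parity stratum, from
ONE odd-level Mazur–Tate element**: `p` odd good, `a_p = 0`, `h12`/`h5`/`h3`/`hpar`/`hFE` by name, and
for the newform `f₀` of level `N_E` a non-zero `Θ ∈ Λ` with `ι Θ = θ_n(f₀)`, `n` odd, `μ(Θ) = 0`,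
`λ(Θ) = deg ω_n^+ + l < pⁿ` with `l ≤ 1` ⇒ `KobayashiLowerDivisibility W p (-1)`
(`lam_signed_neg_one_eq_of_mazurTate`: then `(μ, λ)(L_p^-) = (0, l)` in Kobayashi's labelling).
[cite: Kobayashi2003, Thm. 1.2 and Conjecture (p. 2)] [cite: Pollack2003, Prop. 6.9, 6.10 and 6.18]
[cite: DokchitserDokchitserAnnals2010, Thm. 1.4] [cite: Sprung2017, Cor. 4.14 (a_p = 0 display)] -/
theorem kobayashiLowerDivisibility_neg_one_of_mazurTate
    (h12 : Kobayashi2003.thm12_signedSelmerDual_finite_torsion)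
    (h5 : realPeriodRat_eq_unit_mul_plusPeriod) (h3 : realPeriodRat_eq_unit_mul_plusPeriod_three)
    (hpar : p_parity W p) (hFE : Sprung2017.cor414_sharpFlat_functionalEquation_apZero)
    (hp : p ≠ 2) (hgood : W.HasGoodReductionAtPrime p) (hap : W.frobeniusTrace p = 0)
    [NeZero (W.conductorNorm ℤ)] {f₀ : CuspForm (Gamma0 (W.conductorNorm ℤ)) 2} (hf₀ : IsNewformOf W f₀)
    {n : ℕ} (hn : Odd n) {Θ : IwasawaAlgebra p}
    (hΘ : iwasawaToPowerSeries p Θ =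
      ((mazurTateElement f₀ p n).map (algebraMap ℚ ℚ_[p]) : PowerSeries ℚ_[p]))
    (hΘ0 : Θ ≠ 0) (hμ : mu Θ = 0) {l : ℕ} (hl : l ≤ 1)
    (hlam : lam Θ = (cyclotomicOmegaPlus p n).natDegree + l) (hlt : lam Θ < p ^ n) :
    KobayashiLowerDivisibility W p (-1) :=
  kobayashiLowerDivisibility_of_lam_le_one W p h12 h5 h3 hpar hFE hp hgood hap (-1) hf₀ fun _ hL ↦ by
    obtain ⟨h0, h1⟩ := lam_signed_neg_one_eq_of_mazurTate hp hf₀ hgood hap hL hn hΘ hΘ0 hμ hlam hlt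
    exact ⟨h0, h1 ▸ hl⟩

/-- **The Eisenstein half for `(E, p, 1)` (the tree's `L⁻`, even levels) on the parity stratum, from
ONE even-level Mazur–Tate element** (`λ(Θ) = deg ω_n^- + l < pⁿ`, `n` even, `l ≤ 1`).
[cite: Kobayashi2003, Thm. 1.2 and Conjecture (p. 2)] [cite: Pollack2003, Prop. 6.9, 6.10 and 6.18]
[cite: DokchitserDokchitserAnnals2010, Thm. 1.4] [cite: Sprung2017, Cor. 4.14 (a_p = 0 display)] -/
theorem kobayashiLowerDivisibility_one_of_mazurTate
    (h12 : Kobayashi2003.thm12_signedSelmerDual_finite_torsion)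
    (h5 : realPeriodRat_eq_unit_mul_plusPeriod) (h3 : realPeriodRat_eq_unit_mul_plusPeriod_three)
    (hpar : p_parity W p) (hFE : Sprung2017.cor414_sharpFlat_functionalEquation_apZero)
    (hp : p ≠ 2) (hgood : W.HasGoodReductionAtPrime p) (hap : W.frobeniusTrace p = 0)
    [NeZero (W.conductorNorm ℤ)] {f₀ : CuspForm (Gamma0 (W.conductorNorm ℤ)) 2} (hf₀ : IsNewformOf W f₀)
    {n : ℕ} (hn : Even n) {Θ : IwasawaAlgebra p}
    (hΘ : iwasawaToPowerSeries p Θ =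
      ((mazurTateElement f₀ p n).map (algebraMap ℚ ℚ_[p]) : PowerSeries ℚ_[p]))
    (hΘ0 : Θ ≠ 0) (hμ : mu Θ = 0) {l : ℕ} (hl : l ≤ 1)
    (hlam : lam Θ = (cyclotomicOmegaMinus p n).natDegree + l) (hlt : lam Θ < p ^ n) :
    KobayashiLowerDivisibility W p 1 :=
  kobayashiLowerDivisibility_of_lam_le_one W p h12 h5 h3 hpar hFE hp hgood hap 1 hf₀ fun _ hL ↦ by
    obtain ⟨h0, h1⟩ := lam_signed_one_eq_of_mazurTate hp hf₀ hgood hap hL hn hΘ hΘ0 hμ hlam hlt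
    exact ⟨h0, h1 ▸ hl⟩

/-- **Kobayashi's main conjecture for `(E, p, −1)` from ONE odd-level Mazur–Tate element with
`λ(Θ) = deg ω_n^+ + 1`, surjective `ρ̄_{E,p}`, parity and the functional equation — NO analytic-rank
hypothesis** (the rank-free twin of `kobayashiMainConjecture_neg_one_of_mazurTate_of_analyticRank_eq_one`).
PER PAIR. [cite: Kobayashi2003, Thm. 1.2, Thm. 4.1 and Conjecture (p. 2)] [cite: Pollack2003, Prop. 6.9, 6.10 and 6.18]
[cite: DokchitserDokchitserAnnals2010, Thm. 1.4] [cite: Sprung2017, Cor. 4.14 (a_p = 0 display)]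
[cite: Wuthrich2014, Lemma 20 (p. 399)] -/
theorem kobayashiMainConjecture_neg_one_of_mazurTate_of_p_parity
    (h12 : Kobayashi2003.thm12_signedSelmerDual_finite_torsion)
    (h41 : Kobayashi2003.thm41_signedCharIdeal_divisibility)
    (h5 : realPeriodRat_eq_unit_mul_plusPeriod) (h3 : realPeriodRat_eq_unit_mul_plusPeriod_three)
    (hL20 : Wuthrich2014.lemma20_surjective_threeAdic_of_semistable)
    (hpar : p_parity W p) (hFE : Sprung2017.cor414_sharpFlat_functionalEquation_apZero)
    (hp : p ≠ 2) (hgood : W.HasGoodReductionAtPrime p) (hap : W.frobeniusTrace p = 0) (hs : Surj W p)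
    [NeZero (W.conductorNorm ℤ)] {f₀ : CuspForm (Gamma0 (W.conductorNorm ℤ)) 2} (hf₀ : IsNewformOf W f₀)
    {n : ℕ} (hn : Odd n) {Θ : IwasawaAlgebra p}
    (hΘ : iwasawaToPowerSeries p Θ =
      ((mazurTateElement f₀ p n).map (algebraMap ℚ ℚ_[p]) : PowerSeries ℚ_[p]))
    (hΘ0 : Θ ≠ 0) (hμ : mu Θ = 0) (hlam : lam Θ = (cyclotomicOmegaPlus p n).natDegree + 1)
    (hlt : lam Θ < p ^ n) : KobayashiMainConjecture W p (-1) :=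
  kobayashiMainConjecture_of_lam_eq_one_of_p_parity W p h12 h41 h5 h3 hL20 hpar hFE hp hgood hap hs
    (-1) hf₀ fun _ hL ↦ lam_signed_neg_one_eq_of_mazurTate hp hf₀ hgood hap hL hn hΘ hΘ0 hμ hlam hlt

/-- **Kobayashi's main conjecture for `(E, p, 1)` from ONE even-level Mazur–Tate element with
`λ(Θ) = deg ω_n^- + 1`, surjective `ρ̄_{E,p}`, parity and the functional equation — NO analytic-rank
hypothesis.** PER PAIR. [cite: Kobayashi2003, Thm. 1.2, Thm. 4.1 and Conjecture (p. 2)] [cite: Pollack2003, Prop. 6.9, 6.10 and 6.18]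
[cite: DokchitserDokchitserAnnals2010, Thm. 1.4] [cite: Sprung2017, Cor. 4.14 (a_p = 0 display)]
[cite: Wuthrich2014, Lemma 20 (p. 399)] -/
theorem kobayashiMainConjecture_one_of_mazurTate_of_p_parity
    (h12 : Kobayashi2003.thm12_signedSelmerDual_finite_torsion)
    (h41 : Kobayashi2003.thm41_signedCharIdeal_divisibility)
    (h5 : realPeriodRat_eq_unit_mul_plusPeriod) (h3 : realPeriodRat_eq_unit_mul_plusPeriod_three)
    (hL20 : Wuthrich2014.lemma20_surjective_threeAdic_of_semistable)
    (hpar : p_parity W p) (hFE : Sprung2017.cor414_sharpFlat_functionalEquation_apZero)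
    (hp : p ≠ 2) (hgood : W.HasGoodReductionAtPrime p) (hap : W.frobeniusTrace p = 0) (hs : Surj W p)
    [NeZero (W.conductorNorm ℤ)] {f₀ : CuspForm (Gamma0 (W.conductorNorm ℤ)) 2} (hf₀ : IsNewformOf W f₀)
    {n : ℕ} (hn : Even n) {Θ : IwasawaAlgebra p}
    (hΘ : iwasawaToPowerSeries p Θ =
      ((mazurTateElement f₀ p n).map (algebraMap ℚ ℚ_[p]) : PowerSeries ℚ_[p]))
    (hΘ0 : Θ ≠ 0) (hμ : mu Θ = 0) (hlam : lam Θ = (cyclotomicOmegaMinus p n).natDegree + 1)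
    (hlt : lam Θ < p ^ n) : KobayashiMainConjecture W p 1 :=
  kobayashiMainConjecture_of_lam_eq_one_of_p_parity W p h12 h41 h5 h3 hL20 hpar hFE hp hgood hap hs
    1 hf₀ fun _ hL ↦ lam_signed_one_eq_of_mazurTate hp hf₀ hgood hap hL hn hΘ hΘ0 hμ hlam hlt

end MazurTate

/-! ## §7. Class X7 readings, in the binder shape of crux 3 -/

section X7

variable (W : WeierstrassCurve ℚ) [W.IsElliptic] [W.IsGloballyMinimal] (p : ℕ) [Fact p.Prime]

/-- **Crux 3's conclusion `∃ ε, KobayashiLowerDivisibility W p ε` at an X7 pair ON THE PARITY STRATUM**: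
odd `p`, `ClassX7 W p` (good supersingular, `E` not semistable), `a_p = 0`, and for SOME sign `ε` the
certificate `μ(L_p^ε) = 0 ∧ λ(L_p^ε) ≤ 1` for the newform `f₀` of level `N_E`; granted `h12`, `h5`,
`h3`, `hpar`, `hFE` by name. The crux's binders `¬ W.HasCM` and `Surj W p` are NOT used (displayed with
`_` to match the crux verbatim). What it says about item 19001: the class-wide statement holds on the
sub-population where one signed `p`-adic `L`-function has `p`-adic analytic rank `≤ 1` and `μ = 0`;
the complement (both signs with `λ ≥ 2` or `μ ≥ 1`) is the crux with all its difficulty.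
[cite: Kobayashi2003, Thm. 1.2 and Conjecture (p. 2)] [cite: DokchitserDokchitserAnnals2010, Thm. 1.4]
[cite: Sprung2017, Cor. 4.14 (a_p = 0 display)] -/
theorem X7.exists_kobayashiLowerDivisibility_of_lam_le_one
    (h12 : Kobayashi2003.thm12_signedSelmerDual_finite_torsion)
    (h5 : realPeriodRat_eq_unit_mul_plusPeriod) (h3 : realPeriodRat_eq_unit_mul_plusPeriod_three)
    (hpar : p_parity W p) (hFE : Sprung2017.cor414_sharpFlat_functionalEquation_apZero)
    (hp : p ≠ 2) (hX : ClassX7 W p) (_hCM : ¬ W.HasCM) (hap : W.frobeniusTrace p = 0) (_hs : Surj W p)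
    [NeZero (W.conductorNorm ℤ)] {f₀ : CuspForm (Gamma0 (W.conductorNorm ℤ)) 2} (hf₀ : IsNewformOf W f₀)
    {ε : ℤˣ} (hcert₀ : ∀ L : IwasawaAlgebra p, IsSignedPAdicLFunction f₀ p ε L → mu L = 0 ∧ lam L ≤ 1) :
    ∃ ε : ℤˣ, KobayashiLowerDivisibility W p ε :=
  ⟨ε, kobayashiLowerDivisibility_of_lam_le_one W p h12 h5 h3 hpar hFE hp hX.1.1 hap ε hf₀ hcert₀⟩

/-- **The same for an X7 pair with surjective `ρ̄_{E,p}` and the SHARP certificate `λ = 1`: the full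
main conjecture for that sign**, hence in particular the crux's conclusion — rank-free.
[cite: Kobayashi2003, Thm. 1.2, Thm. 4.1 and Conjecture (p. 2)] [cite: DokchitserDokchitserAnnals2010, Thm. 1.4]
[cite: Sprung2017, Cor. 4.14 (a_p = 0 display)] [cite: Wuthrich2014, Lemma 20 (p. 399)] -/
theorem X7.kobayashiMainConjecture_of_lam_eq_one_of_p_parity
    (h12 : Kobayashi2003.thm12_signedSelmerDual_finite_torsion)
    (h41 : Kobayashi2003.thm41_signedCharIdeal_divisibility)
    (h5 : realPeriodRat_eq_unit_mul_plusPeriod) (h3 : realPeriodRat_eq_unit_mul_plusPeriod_three)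
    (hL20 : Wuthrich2014.lemma20_surjective_threeAdic_of_semistable)
    (hpar : p_parity W p) (hFE : Sprung2017.cor414_sharpFlat_functionalEquation_apZero)
    (hp : p ≠ 2) (hX : ClassX7 W p) (hap : W.frobeniusTrace p = 0) (hs : Surj W p) (ε : ℤˣ)
    [NeZero (W.conductorNorm ℤ)] {f₀ : CuspForm (Gamma0 (W.conductorNorm ℤ)) 2} (hf₀ : IsNewformOf W f₀)
    (hcert₀ : ∀ L : IwasawaAlgebra p, IsSignedPAdicLFunction f₀ p ε L → mu L = 0 ∧ lam L = 1) :
    KobayashiMainConjecture W p ε :=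
  LargeImageParityStratum.kobayashiMainConjecture_of_lam_eq_one_of_p_parity W p h12 h41 h5 h3 hL20 hpar
    hFE hp hX.1.1 hap hs ε hf₀ hcert₀

end X7

end Summit.BirchSwinnertonDyer.BirchSwinnertonDyer.Theorems.LargeImageParityStratum

end
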